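import Literature.Topology.FourManifolds.GluckTwist
import HarnessLib

/-!
# Complex stereographic coordinates on the round 2-sphere

Explicit complex coordinates on `𝕊 2 = Metric.sphere (0 : ℝ³) 1` adapted to the rotations
`Literature.Topology.FourManifolds.rotateSphereTwo` about the polar axis (Gluck's `rot_θ`), for
use in the toric description of the blow-up of `S² × ℝ²` (`ToricBlowupModel.lean`):

* `northPole = (0,0,1)`, `southPole = (0,0,-1)`;
* `zeta x = (x₀ + i x₁)/(1 - x₂)` — stereographic coordinate from the north pole
  (`zeta southPole = 0`; junk value at the north pole, where `ζ = ∞`), and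
  `xi x = (x₀ - i x₁)/(1 + x₂) = 1 / zeta x` — the coordinate at the other pole;
* the inverse maps `invZeta`, `invXi : ℂ → 𝕊 2` (smooth, `zeta (invZeta ζ) = ζ`, …);
* `zeta (rotateSphereTwo u x) = u • zeta x`, `xi (rotateSphereTwo u x) = ū • xi x`
  (`u ∈ 𝕊 1` read as a unit complex number, `circleComplex`);
* smoothness of `zeta` off the north pole and of `xi` off the south pole.

Everything is elementary coordinate algebra on the sphere `x₀² + x₁² + x₂² = 1`; the change of
charts `ξ = 1/ζ` is the holomorphic atlas of the Riemann sphere (Griffiths–Harris,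
*Principles of Algebraic Geometry*, Ch. 0 §2). As in `ComplexProjectiveSpaceProofs.lean`
(the tree's `ℂℙ¹ ≅ 𝕊²`), only Mathlib's `contMDiff_coe_sphere` and
`ContMDiff.codRestrict_sphere` are used about the manifold structure of the sphere: every
function on the sphere is written as a smooth function of `ℝ³` restricted to it.
-/

noncomputable section

open scoped Manifold ContDiff Topology ComplexConjugate
open Set Function Metric Module Complex

namespace Literature.Topology.FourManifolds

/-- Local notation: `𝔼 n` is the model Euclidean space `EuclideanSpace ℝ (Fin n)`. -/
local notation "𝔼 " n:arg => EuclideanSpace ℝ (Fin n)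

/-- Local notation: `𝕊 n` is the unit sphere in `EuclideanSpace ℝ (Fin (n + 1))`. -/
local notation "𝕊 " n:arg => (Metric.sphere (0 : EuclideanSpace ℝ (Fin (n + 1))) 1)

namespace SphereCoord

/-! ### Poles and coordinates -/

/-- The sphere relation `x₀² + x₁² + x₂² = 1`. [folklore] -/
theorem coord_sq (x : 𝕊 2) :
    (x : 𝔼 3) 0 ^ 2 + (x : 𝔼 3) 1 ^ 2 + (x : 𝔼 3) 2 ^ 2 = 1 := by
  have h : ‖(x : 𝔼 3)‖ ^ 2 = 1 := by rw [norm_eq_of_mem_sphere x, one_pow]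
  rwa [EuclideanSpace.real_norm_sq_eq, Fin.sum_univ_three] at h

/-- A vector `(a, b, c)` of `ℝ³` with `a² + b² + c² = 1` as a point of `𝕊 2`. [folklore] -/
def mkPt (a b c : ℝ) (h : a ^ 2 + b ^ 2 + c ^ 2 = 1) : 𝕊 2 :=
  ⟨WithLp.toLp 2 ![a, b, c], by
    rw [mem_sphere_zero_iff_norm, EuclideanSpace.norm_eq, Real.sqrt_eq_one, Fin.sum_univ_three]
    simpa using h⟩

/-- Coordinates of `mkPt`. [folklore] -/
@[simp] theorem mkPt_apply_zero (a b c : ℝ) (h : a ^ 2 + b ^ 2 + c ^ 2 = 1) :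
    (mkPt a b c h : 𝔼 3) 0 = a := rfl

/-- Coordinates of `mkPt`. [folklore] -/
@[simp] theorem mkPt_apply_one (a b c : ℝ) (h : a ^ 2 + b ^ 2 + c ^ 2 = 1) :
    (mkPt a b c h : 𝔼 3) 1 = b := rfl

/-- Coordinates of `mkPt`. [folklore] -/
@[simp] theorem mkPt_apply_two (a b c : ℝ) (h : a ^ 2 + b ^ 2 + c ^ 2 = 1) :
    (mkPt a b c h : 𝔼 3) 2 = c := rfl

/-- Two points of `𝕊 2` are equal iff their three coordinates are. [folklore] -/
theorem ext_iff' (x y : 𝕊 2) : x = y ↔ (x : 𝔼 3) 0 = (y : 𝔼 3) 0 ∧ (x : 𝔼 3) 1 = (y : 𝔼 3) 1 ∧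
    (x : 𝔼 3) 2 = (y : 𝔼 3) 2 := by
  constructor
  · rintro rfl; exact ⟨rfl, rfl, rfl⟩
  · rintro ⟨h0, h1, h2⟩
    apply Subtype.ext
    ext i
    fin_cases i
    · exact h0
    · exact h1
    · exact h2

/-- The north pole `N = (0, 0, 1)` (the pole of the stereographic coordinate `zeta`). [folklore] -/
def northPole : 𝕊 2 := mkPt 0 0 1 (by norm_num)

/-- The south pole `S = (0, 0, -1)`. [folklore] -/
def southPole : 𝕊 2 := mkPt 0 0 (-1) (by norm_num)

/-- A point of `𝕊 2` is the north pole iff its last coordinate is `1`. [folklore] -/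
theorem eq_northPole_iff (x : 𝕊 2) : x = northPole ↔ (x : 𝔼 3) 2 = 1 := by
  rw [ext_iff']
  constructor
  · rintro ⟨-, -, h⟩; exact h
  · intro h
    have hs := coord_sq x
    rw [h] at hs
    have h0 : (x : 𝔼 3) 0 = 0 := by nlinarith [sq_nonneg ((x : 𝔼 3) 0), sq_nonneg ((x : 𝔼 3) 1)]
    have h1 : (x : 𝔼 3) 1 = 0 := by nlinarith [sq_nonneg ((x : 𝔼 3) 0), sq_nonneg ((x : 𝔼 3) 1)]
    exact ⟨h0, h1, h⟩

/-- A point of `𝕊 2` is the south pole iff its last coordinate is `-1`. [folklore] -/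
theorem eq_southPole_iff (x : 𝕊 2) : x = southPole ↔ (x : 𝔼 3) 2 = -1 := by
  rw [ext_iff']
  constructor
  · rintro ⟨-, -, h⟩; exact h
  · intro h
    have hs := coord_sq x
    rw [h] at hs
    have h0 : (x : 𝔼 3) 0 = 0 := by nlinarith [sq_nonneg ((x : 𝔼 3) 0), sq_nonneg ((x : 𝔼 3) 1)]
    have h1 : (x : 𝔼 3) 1 = 0 := by nlinarith [sq_nonneg ((x : 𝔼 3) 0), sq_nonneg ((x : 𝔼 3) 1)]
    exact ⟨h0, h1, h⟩

/-- The last coordinate of a point of the sphere is at most `1`. [folklore] -/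
theorem coord_two_le_one (x : 𝕊 2) : (x : 𝔼 3) 2 ≤ 1 := by
  nlinarith [coord_sq x, sq_nonneg ((x : 𝔼 3) 0), sq_nonneg ((x : 𝔼 3) 1),
    sq_nonneg ((x : 𝔼 3) 2 - 1)]

/-- The last coordinate of a point of the sphere is at least `-1`. [folklore] -/
theorem neg_one_le_coord_two (x : 𝕊 2) : -1 ≤ (x : 𝔼 3) 2 := by
  nlinarith [coord_sq x, sq_nonneg ((x : 𝔼 3) 0), sq_nonneg ((x : 𝔼 3) 1),
    sq_nonneg ((x : 𝔼 3) 2 + 1)]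

/-- Off the north pole, `1 - x₂ > 0`. [folklore] -/
theorem one_sub_pos {x : 𝕊 2} (hx : x ≠ northPole) : 0 < 1 - (x : 𝔼 3) 2 := by
  have h := coord_two_le_one x
  rw [Ne, eq_northPole_iff] at hx
  exact sub_pos.2 (lt_of_le_of_ne h hx)

/-- Off the south pole, `1 + x₂ > 0`. [folklore] -/
theorem one_add_pos {x : 𝕊 2} (hx : x ≠ southPole) : 0 < 1 + (x : 𝔼 3) 2 := by
  have h := neg_one_le_coord_two x
  rw [Ne, eq_southPole_iff] at hx
  have h' : (-1 : ℝ) ≠ (x : 𝔼 3) 2 := fun h'' => hx h''.symm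
  have := lt_of_le_of_ne h h'
  linarith

/-- The north and south poles are distinct. [folklore] -/
theorem northPole_ne_southPole : northPole ≠ southPole := by
  rw [Ne, eq_southPole_iff]; norm_num [northPole]

/-- The **equatorial complex coordinate** `x₀ + i x₁` of a point of `𝕊 2`. [folklore] -/
def eqC (x : 𝕊 2) : ℂ := ⟨(x : 𝔼 3) 0, (x : 𝔼 3) 1⟩

/-- Real part of `eqC`. [folklore] -/
@[simp] theorem eqC_re (x : 𝕊 2) : (eqC x).re = (x : 𝔼 3) 0 := rfl

/-- Imaginary part of `eqC`. [folklore] -/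
@[simp] theorem eqC_im (x : 𝕊 2) : (eqC x).im = (x : 𝔼 3) 1 := rfl

/-- `|x₀ + i x₁|² = (1 - x₂)(1 + x₂)` on the sphere. [folklore] -/
theorem normSq_eqC (x : 𝕊 2) : normSq (eqC x) = (1 - (x : 𝔼 3) 2) * (1 + (x : 𝔼 3) 2) := by
  rw [normSq_apply, eqC_re, eqC_im]
  nlinarith [coord_sq x]

/-- **The stereographic coordinate from the north pole** `ζ = (x₀ + i x₁)/(1 - x₂)`
(junk value at the north pole itself, where `ζ = ∞`); `ζ = 0` at the south pole. [folklore] -/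
def zeta (x : 𝕊 2) : ℂ := eqC x * (((1 - (x : 𝔼 3) 2 : ℝ) : ℂ))⁻¹

/-- **The coordinate at the south pole** `ξ = (x₀ - i x₁)/(1 + x₂) = 1/ζ` (conjugate of the
stereographic coordinate from the south pole; junk value at the south pole). [folklore] -/
def xi (x : 𝕊 2) : ℂ := conj (eqC x) * (((1 + (x : 𝔼 3) 2 : ℝ) : ℂ))⁻¹

/-- Off the north pole the denominator of `ζ` is a nonzero complex number. [folklore] -/
theorem den_zeta_ne_zero {x : 𝕊 2} (hN : x ≠ northPole) : ((1 - (x : 𝔼 3) 2 : ℝ) : ℂ) ≠ 0 :=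
  ofReal_ne_zero.2 (one_sub_pos hN).ne'

/-- Off the south pole the denominator of `ξ` is a nonzero complex number. [folklore] -/
theorem den_xi_ne_zero {x : 𝕊 2} (hS : x ≠ southPole) : ((1 + (x : 𝔼 3) 2 : ℝ) : ℂ) ≠ 0 :=
  ofReal_ne_zero.2 (one_add_pos hS).ne'

/-- `ζ ξ = 1` off the poles: `(x₀ + i x₁)(x₀ - i x₁) = x₀² + x₁² = (1 - x₂)(1 + x₂)`. [folklore] -/
theorem zeta_mul_xi {x : 𝕊 2} (hN : x ≠ northPole) (hS : x ≠ southPole) : zeta x * xi x = 1 := by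
  have h1 := den_zeta_ne_zero hN
  have h2 := den_xi_ne_zero hS
  have key : zeta x * xi x = (eqC x * conj (eqC x)) * ((((1 - (x : 𝔼 3) 2 : ℝ) : ℂ))⁻¹ *
      (((1 + (x : 𝔼 3) 2 : ℝ) : ℂ))⁻¹) := by
    rw [zeta, xi]; ring
  rw [key, mul_conj, normSq_eqC]
  push_cast at h1 h2 ⊢
  field_simp

/-- `ξ = ζ⁻¹` off the poles. [folklore] -/
theorem xi_eq_inv_zeta {x : 𝕊 2} (hN : x ≠ northPole) (hS : x ≠ southPole) : xi x = (zeta x)⁻¹ :=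
  eq_inv_of_mul_eq_one_right (zeta_mul_xi hN hS)

/-- `ζ = ξ⁻¹` off the poles. [folklore] -/
theorem zeta_eq_inv_xi {x : 𝕊 2} (hN : x ≠ northPole) (hS : x ≠ southPole) : zeta x = (xi x)⁻¹ := by
  rw [xi_eq_inv_zeta hN hS, inv_inv]

/-- `eqC x = 0` iff `x` is a pole. [folklore] -/
theorem eqC_eq_zero_iff (x : 𝕊 2) : eqC x = 0 ↔ x = northPole ∨ x = southPole := by
  rw [← normSq_eq_zero, normSq_eqC, mul_eq_zero, eq_northPole_iff, eq_southPole_iff]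
  constructor
  · rintro (h | h)
    · exact Or.inl (by linarith)
    · exact Or.inr (by linarith)
  · rintro (h | h)
    · exact Or.inl (by linarith)
    · exact Or.inr (by linarith)

/-- Off the north pole, `ζ = 0` iff `x` is the south pole. [folklore] -/
theorem zeta_eq_zero_iff {x : 𝕊 2} (hN : x ≠ northPole) : zeta x = 0 ↔ x = southPole := by
  rw [zeta, mul_eq_zero, inv_eq_zero, eqC_eq_zero_iff]
  have h1 := den_zeta_ne_zero hN
  constructor
  · rintro ((h | h) | h)
    · exact absurd h hN
    · exact h
    · exact absurd h h1
  · exact fun h => Or.inl (Or.inr h)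

/-- Off the south pole, `ξ = 0` iff `x` is the north pole. [folklore] -/
theorem xi_eq_zero_iff {x : 𝕊 2} (hS : x ≠ southPole) : xi x = 0 ↔ x = northPole := by
  rw [xi, mul_eq_zero, inv_eq_zero, map_eq_zero, eqC_eq_zero_iff]
  have h1 := den_xi_ne_zero hS
  constructor
  · rintro ((h | h) | h)
    · exact h
    · exact absurd h hS
    · exact absurd h h1
  · exact fun h => Or.inl (Or.inl h)

/-- `ζ` of the south pole is `0`. [folklore] -/
@[simp] theorem zeta_southPole : zeta southPole = 0 :=
  (zeta_eq_zero_iff northPole_ne_southPole.symm).2 rfl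

/-- `ξ` of the north pole is `0`. [folklore] -/
@[simp] theorem xi_northPole : xi northPole = 0 :=
  (xi_eq_zero_iff northPole_ne_southPole).2 rfl

/-- `|ζ|² = (1 + x₂)/(1 - x₂)` off the north pole. [folklore] -/
theorem normSq_zeta {x : 𝕊 2} (hN : x ≠ northPole) :
    normSq (zeta x) = (1 + (x : 𝔼 3) 2) / (1 - (x : 𝔼 3) 2) := by
  have h1 := (one_sub_pos hN).ne'
  rw [zeta, normSq_mul, normSq_inv, normSq_ofReal, normSq_eqC]
  field_simp

/-- `|ξ|² = (1 - x₂)/(1 + x₂)` off the south pole. [folklore] -/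
theorem normSq_xi {x : 𝕊 2} (hS : x ≠ southPole) :
    normSq (xi x) = (1 - (x : 𝔼 3) 2) / (1 + (x : 𝔼 3) 2) := by
  have h1 := (one_add_pos hS).ne'
  rw [xi, normSq_mul, normSq_inv, normSq_ofReal, normSq_conj, normSq_eqC]
  field_simp

/-- Real part of `ζ`. [folklore] -/
theorem zeta_re (x : 𝕊 2) : (zeta x).re = (x : 𝔼 3) 0 / (1 - (x : 𝔼 3) 2) := by
  rw [zeta, ← ofReal_inv, mul_comm, re_ofReal_mul, eqC_re]; ring

/-- Imaginary part of `ζ`. [folklore] -/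
theorem zeta_im (x : 𝕊 2) : (zeta x).im = (x : 𝔼 3) 1 / (1 - (x : 𝔼 3) 2) := by
  rw [zeta, ← ofReal_inv, mul_comm, im_ofReal_mul, eqC_im]; ring

/-- Real part of `ξ`. [folklore] -/
theorem xi_re (x : 𝕊 2) : (xi x).re = (x : 𝔼 3) 0 / (1 + (x : 𝔼 3) 2) := by
  rw [xi, ← ofReal_inv, mul_comm, re_ofReal_mul, conj_re, eqC_re]; ring

/-- Imaginary part of `ξ`. [folklore] -/
theorem xi_im (x : 𝕊 2) : (xi x).im = -(x : 𝔼 3) 1 / (1 + (x : 𝔼 3) 2) := by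
  rw [xi, ← ofReal_inv, mul_comm, im_ofReal_mul, conj_im, eqC_im]; ring

/-! ### The inverse coordinate maps -/

/-- `|ζ|² + 1 > 0`. [folklore] -/
theorem normSq_add_one_pos (ζ : ℂ) : 0 < normSq ζ + 1 :=
  add_pos_of_nonneg_of_pos (normSq_nonneg ζ) one_pos

/-- The norm identity behind the inverse stereographic projection:
`(2a)² + (2b)² + (a² + b² - 1)² = (a² + b² + 1)²`. [folklore] -/
theorem inv_coord_sq (ζ : ℂ) :
    (2 * ζ.re / (normSq ζ + 1)) ^ 2 + (2 * ζ.im / (normSq ζ + 1)) ^ 2 +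
      ((normSq ζ - 1) / (normSq ζ + 1)) ^ 2 = 1 := by
  have h : normSq ζ + 1 ≠ 0 := (normSq_add_one_pos ζ).ne'
  field_simp
  rw [normSq_apply]
  ring

/-- **Inverse of `zeta`**: the point of `𝕊 2` with stereographic coordinate `ζ`,
`(2 Re ζ, 2 Im ζ, |ζ|² - 1)/(|ζ|² + 1)`. [folklore] -/
def invZeta (ζ : ℂ) : 𝕊 2 :=
  mkPt (2 * ζ.re / (normSq ζ + 1)) (2 * ζ.im / (normSq ζ + 1)) ((normSq ζ - 1) / (normSq ζ + 1))
    (inv_coord_sq ζ)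

/-- **Inverse of `xi`**: the point of `𝕊 2` with `ξ`-coordinate `u`,
`(2 Re u, -2 Im u, 1 - |u|²)/(|u|² + 1)`. [folklore] -/
def invXi (u : ℂ) : 𝕊 2 :=
  mkPt (2 * u.re / (normSq u + 1)) (-(2 * u.im / (normSq u + 1)))
    (-((normSq u - 1) / (normSq u + 1)))
    (by have := inv_coord_sq u; nlinarith [this])

/-- `invZeta ζ` is never the north pole. [folklore] -/
theorem invZeta_ne_northPole (ζ : ℂ) : invZeta ζ ≠ northPole := by
  rw [Ne, eq_northPole_iff, invZeta, mkPt_apply_two]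
  have h : normSq ζ + 1 ≠ 0 := (normSq_add_one_pos ζ).ne'
  rw [div_eq_one_iff_eq h]
  linarith

/-- `invXi u` is never the south pole. [folklore] -/
theorem invXi_ne_southPole (u : ℂ) : invXi u ≠ southPole := by
  rw [Ne, eq_southPole_iff, invXi, mkPt_apply_two]
  have h1 : normSq u + 1 ≠ 0 := (normSq_add_one_pos u).ne'
  intro h'
  rw [neg_eq_iff_eq_neg, neg_neg, div_eq_one_iff_eq h1] at h'
  linarith

/-- `zeta (invZeta ζ) = ζ`. [folklore] -/
@[simp] theorem zeta_invZeta (ζ : ℂ) : zeta (invZeta ζ) = ζ := by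
  have h : normSq ζ + 1 ≠ 0 := (normSq_add_one_pos ζ).ne'
  have h2 : (1 : ℝ) - (normSq ζ - 1) / (normSq ζ + 1) ≠ 0 := by
    rw [sub_ne_zero, ne_comm, Ne, div_eq_one_iff_eq h]; linarith
  apply Complex.ext
  · rw [zeta_re]
    simp only [invZeta, mkPt_apply_zero, mkPt_apply_two]
    field_simp
    ring
  · rw [zeta_im]
    simp only [invZeta, mkPt_apply_one, mkPt_apply_two]
    field_simp
    ring

/-- `xi (invXi u) = u`. [folklore] -/
@[simp] theorem xi_invXi (u : ℂ) : xi (invXi u) = u := by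
  have h : normSq u + 1 ≠ 0 := (normSq_add_one_pos u).ne'
  have h2 : (1 : ℝ) + -((normSq u - 1) / (normSq u + 1)) ≠ 0 := by
    rw [← sub_eq_add_neg, sub_ne_zero, ne_comm, Ne, div_eq_one_iff_eq h]; linarith
  apply Complex.ext
  · rw [xi_re]
    simp only [invXi, mkPt_apply_zero, mkPt_apply_two]
    field_simp
    ring
  · rw [xi_im]
    simp only [invXi, mkPt_apply_one, mkPt_apply_two]
    field_simp
    ring

/-- `invZeta (zeta x) = x` off the north pole. [folklore] -/
theorem invZeta_zeta {x : 𝕊 2} (hN : x ≠ northPole) : invZeta (zeta x) = x := by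
  have h1 := (one_sub_pos hN).ne'
  have hs := coord_sq x
  have hn := normSq_zeta hN
  have hd : normSq (zeta x) + 1 = 2 / (1 - (x : 𝔼 3) 2) := by
    rw [hn]; field_simp; ring
  rw [ext_iff']
  simp only [invZeta, mkPt_apply_zero, mkPt_apply_one, mkPt_apply_two, hn, zeta_re, zeta_im]
  refine ⟨?_, ?_, ?_⟩ <;> field_simp <;> ring

/-- `invXi (xi x) = x` off the south pole. [folklore] -/
theorem invXi_xi {x : 𝕊 2} (hS : x ≠ southPole) : invXi (xi x) = x := by
  have h1 := (one_add_pos hS).ne'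
  have hs := coord_sq x
  have hn := normSq_xi hS
  have hd : normSq (xi x) + 1 = 2 / (1 + (x : 𝔼 3) 2) := by
    rw [hn]; field_simp; ring
  rw [ext_iff']
  simp only [invXi, mkPt_apply_zero, mkPt_apply_one, mkPt_apply_two, hn, xi_re, xi_im]
  refine ⟨?_, ?_, ?_⟩ <;> field_simp <;> ring

/-- `zeta` is injective off the north pole. [folklore] -/
theorem zeta_injOn : InjOn zeta {x | x ≠ northPole} := fun x hx y hy h => by
  rw [← invZeta_zeta hx, ← invZeta_zeta hy, h]

/-- `xi` is injective off the south pole. [folklore] -/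
theorem xi_injOn : InjOn xi {x | x ≠ southPole} := fun x hx y hy h => by
  rw [← invXi_xi hx, ← invXi_xi hy, h]

/-- `invZeta` is injective. [folklore] -/
theorem invZeta_injective : Injective invZeta := fun a b h => by
  rw [← zeta_invZeta a, ← zeta_invZeta b, h]

/-- `invXi` is injective. [folklore] -/
theorem invXi_injective : Injective invXi := fun a b h => by
  rw [← xi_invXi a, ← xi_invXi b, h]

/-- The range of `invZeta` is the complement of the north pole. [folklore] -/
theorem range_invZeta : range invZeta = {x | x ≠ northPole} :=
  Subset.antisymm (by rintro _ ⟨ζ, rfl⟩; exact invZeta_ne_northPole ζ)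
    fun x hx => ⟨zeta x, invZeta_zeta hx⟩

/-- The range of `invXi` is the complement of the south pole. [folklore] -/
theorem range_invXi : range invXi = {x | x ≠ southPole} :=
  Subset.antisymm (by rintro _ ⟨u, rfl⟩; exact invXi_ne_southPole u)
    fun x hx => ⟨xi x, invXi_xi hx⟩

/-- `invZeta 0` is the south pole. [folklore] -/
@[simp] theorem invZeta_zero : invZeta 0 = southPole := by
  rw [← zeta_southPole, invZeta_zeta northPole_ne_southPole.symm]

/-- `invXi 0` is the north pole. [folklore] -/
@[simp] theorem invXi_zero : invXi 0 = northPole := by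
  rw [← xi_northPole, invXi_xi northPole_ne_southPole]

/-- `invXi u` is the north pole iff `u = 0`. [folklore] -/
theorem invXi_eq_northPole_iff (u : ℂ) : invXi u = northPole ↔ u = 0 :=
  ⟨fun h => by rw [← xi_invXi u, h, xi_northPole], fun h => by rw [h, invXi_zero]⟩

/-- `invZeta ζ` is the south pole iff `ζ = 0`. [folklore] -/
theorem invZeta_eq_southPole_iff (ζ : ℂ) : invZeta ζ = southPole ↔ ζ = 0 :=
  ⟨fun h => by rw [← zeta_invZeta ζ, h, zeta_southPole], fun h => by rw [h, invZeta_zero]⟩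

/-- `invXi u = invZeta u⁻¹` for `u ≠ 0` (the change of charts `ζ = 1/ξ`). [folklore] -/
theorem invXi_eq_invZeta_inv {u : ℂ} (hu : u ≠ 0) : invXi u = invZeta u⁻¹ := by
  have hS : invXi u ≠ southPole := invXi_ne_southPole u
  have hN : invXi u ≠ northPole := fun h => hu ((invXi_eq_northPole_iff u).1 h)
  apply zeta_injOn hN (invZeta_ne_northPole _)
  rw [zeta_invZeta, zeta_eq_inv_xi hN hS, xi_invXi]

/-- `invZeta ζ = invXi ζ⁻¹` for `ζ ≠ 0`. [folklore] -/
theorem invZeta_eq_invXi_inv {ζ : ℂ} (hζ : ζ ≠ 0) : invZeta ζ = invXi ζ⁻¹ := by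
  rw [invXi_eq_invZeta_inv (inv_ne_zero hζ), inv_inv]

/-- `ξ (invZeta ζ) = ζ⁻¹` for `ζ ≠ 0`. [folklore] -/
theorem xi_invZeta {ζ : ℂ} (hζ : ζ ≠ 0) : xi (invZeta ζ) = ζ⁻¹ := by
  rw [invZeta_eq_invXi_inv hζ, xi_invXi]

/-- `ζ (invXi u) = u⁻¹` for `u ≠ 0`. [folklore] -/
theorem zeta_invXi {u : ℂ} (hu : u ≠ 0) : zeta (invXi u) = u⁻¹ := by
  rw [invXi_eq_invZeta_inv hu, zeta_invZeta]

/-! ### Smoothness -/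

/-- The equatorial coordinate as a function on `ℝ³`. [folklore] -/
def eqCVec (v : 𝔼 3) : ℂ := ⟨v 0, v 1⟩

/-- `eqC` is the restriction of `eqCVec`. [folklore] -/
theorem eqC_eq (x : 𝕊 2) : eqC x = eqCVec (x : 𝔼 3) := rfl

/-- `eqCVec` is smooth (it is linear). [folklore] -/
theorem contDiff_eqCVec : ContDiff ℝ ∞ eqCVec := by
  have h : ContDiff ℝ ∞ fun v : 𝔼 3 => ((v 0, v 1) : ℝ × ℝ) := by fun_prop
  exact Complex.equivRealProdCLM.symm.contDiff.comp h

/-- `ζ` as a function on `ℝ³`. [folklore] -/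
def zetaVec (v : 𝔼 3) : ℂ := eqCVec v * (((1 - v 2 : ℝ) : ℂ))⁻¹

/-- `ξ` as a function on `ℝ³`. [folklore] -/
def xiVec (v : 𝔼 3) : ℂ := conj (eqCVec v) * (((1 + v 2 : ℝ) : ℂ))⁻¹

/-- `zeta` is the restriction of `zetaVec`. [folklore] -/
theorem zeta_eq (x : 𝕊 2) : zeta x = zetaVec (x : 𝔼 3) := rfl

/-- `xi` is the restriction of `xiVec`. [folklore] -/
theorem xi_eq (x : 𝕊 2) : xi x = xiVec (x : 𝔼 3) := rfl

/-- `zetaVec` is smooth where `v₂ ≠ 1`. [folklore] -/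
theorem contDiffAt_zetaVec {v : 𝔼 3} (hv : 1 - v 2 ≠ 0) : ContDiffAt ℝ ∞ zetaVec v := by
  have h1 : ContDiffAt ℝ ∞ (fun w : 𝔼 3 => ((1 - w 2 : ℝ) : ℂ)) v :=
    (Complex.ofRealCLM.contDiff.comp (by fun_prop : ContDiff ℝ ∞ fun w : 𝔼 3 => (1 - w 2 : ℝ)))
      |>.contDiffAt
  have h2 : ((1 - v 2 : ℝ) : ℂ) ≠ 0 := ofReal_ne_zero.2 hv
  exact contDiff_eqCVec.contDiffAt.mul (h1.inv h2)

/-- `xiVec` is smooth where `v₂ ≠ -1`. [folklore] -/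
theorem contDiffAt_xiVec {v : 𝔼 3} (hv : 1 + v 2 ≠ 0) : ContDiffAt ℝ ∞ xiVec v := by
  have h1 : ContDiffAt ℝ ∞ (fun w : 𝔼 3 => ((1 + w 2 : ℝ) : ℂ)) v :=
    (Complex.ofRealCLM.contDiff.comp (by fun_prop : ContDiff ℝ ∞ fun w : 𝔼 3 => (1 + w 2 : ℝ)))
      |>.contDiffAt
  have h2 : ((1 + v 2 : ℝ) : ℂ) ≠ 0 := ofReal_ne_zero.2 hv
  exact (Complex.conjCLE.contDiff.comp contDiff_eqCVec).contDiffAt.mul (h1.inv h2)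

/-- The inclusion `𝕊 2 → ℝ³` is smooth (Mathlib's `contMDiff_coe_sphere` at `n = 2`). [folklore] -/
theorem contMDiff_coe : ContMDiff (𝓡 2) 𝓘(ℝ, 𝔼 3) ∞ (fun x : 𝕊 2 => (x : 𝔼 3)) := by
  haveI := Fact.mk (@finrank_euclideanSpace_fin ℝ _ (2 + 1))
  exact contMDiff_coe_sphere (n := 2)

/-- `eqC` is smooth. [folklore] -/
theorem contMDiff_eqC : ContMDiff (𝓡 2) 𝓘(ℝ, ℂ) ∞ eqC :=
  contDiff_eqCVec.comp_contMDiff contMDiff_coe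

/-- **`zeta` is smooth off the north pole.** [folklore] -/
theorem contMDiffAt_zeta {x : 𝕊 2} (hN : x ≠ northPole) : ContMDiffAt (𝓡 2) 𝓘(ℝ, ℂ) ∞ zeta x :=
  (contDiffAt_zetaVec (one_sub_pos hN).ne').comp_contMDiffAt contMDiff_coe.contMDiffAt

/-- **`xi` is smooth off the south pole.** [folklore] -/
theorem contMDiffAt_xi {x : 𝕊 2} (hS : x ≠ southPole) : ContMDiffAt (𝓡 2) 𝓘(ℝ, ℂ) ∞ xi x :=
  (contDiffAt_xiVec (one_add_pos hS).ne').comp_contMDiffAt contMDiff_coe.contMDiffAt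

/-- `zeta` is smooth on the complement of the north pole. [folklore] -/
theorem contMDiffOn_zeta : ContMDiffOn (𝓡 2) 𝓘(ℝ, ℂ) ∞ zeta {x | x ≠ northPole} :=
  fun _ hx => (contMDiffAt_zeta hx).contMDiffWithinAt

/-- `xi` is smooth on the complement of the south pole. [folklore] -/
theorem contMDiffOn_xi : ContMDiffOn (𝓡 2) 𝓘(ℝ, ℂ) ∞ xi {x | x ≠ southPole} :=
  fun _ hx => (contMDiffAt_xi hx).contMDiffWithinAt

/-- `ζ ↦ |ζ|²` is smooth (over `ℝ`). [folklore] -/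
theorem contDiff_normSq : ContDiff ℝ ∞ fun ζ : ℂ => normSq ζ := by
  have h1 : ContDiff ℝ ∞ fun ζ : ℂ => ζ.re := Complex.reCLM.contDiff
  have h2 : ContDiff ℝ ∞ fun ζ : ℂ => ζ.im := Complex.imCLM.contDiff
  have : (fun ζ : ℂ => normSq ζ) = fun ζ => ζ.re * ζ.re + ζ.im * ζ.im := by
    funext ζ; exact normSq_apply ζ
  rw [this]
  exact (h1.mul h1).add (h2.mul h2)

/-- The `ℝ³`-valued inverse stereographic map is smooth. [folklore] -/
theorem contDiff_invZetaVec : ContDiff ℝ ∞ fun ζ : ℂ => (invZeta ζ : 𝔼 3) := by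
  have hd : ∀ ζ : ℂ, normSq ζ + 1 ≠ 0 := fun ζ => (normSq_add_one_pos ζ).ne'
  have hn := contDiff_normSq
  have h : (fun ζ : ℂ => (invZeta ζ : 𝔼 3)) = fun ζ => WithLp.toLp 2
      ![2 * ζ.re / (normSq ζ + 1), 2 * ζ.im / (normSq ζ + 1), (normSq ζ - 1) / (normSq ζ + 1)] := rfl
  rw [h]
  apply PiLp.contDiff_toLp.comp
  rw [contDiff_pi]
  intro i
  fin_cases i
  · exact (contDiff_const.mul Complex.reCLM.contDiff).div (hn.add contDiff_const) hd
  · exact (contDiff_const.mul Complex.imCLM.contDiff).div (hn.add contDiff_const) hd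
  · exact (hn.sub contDiff_const).div (hn.add contDiff_const) hd

/-- The `ℝ³`-valued inverse of `xi` is smooth. [folklore] -/
theorem contDiff_invXiVec : ContDiff ℝ ∞ fun u : ℂ => (invXi u : 𝔼 3) := by
  have hd : ∀ ζ : ℂ, normSq ζ + 1 ≠ 0 := fun ζ => (normSq_add_one_pos ζ).ne'
  have hn := contDiff_normSq
  have h : (fun u : ℂ => (invXi u : 𝔼 3)) = fun u => WithLp.toLp 2
      ![2 * u.re / (normSq u + 1), -(2 * u.im / (normSq u + 1)),
        -((normSq u - 1) / (normSq u + 1))] := rfl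
  rw [h]
  apply PiLp.contDiff_toLp.comp
  rw [contDiff_pi]
  intro i
  fin_cases i
  · exact (contDiff_const.mul Complex.reCLM.contDiff).div (hn.add contDiff_const) hd
  · exact ((contDiff_const.mul Complex.imCLM.contDiff).div (hn.add contDiff_const) hd).neg
  · exact ((hn.sub contDiff_const).div (hn.add contDiff_const) hd).neg

/-- **`invZeta` is smooth.** [folklore] -/
theorem contMDiff_invZeta : ContMDiff 𝓘(ℝ, ℂ) (𝓡 2) ∞ invZeta := by
  haveI := Fact.mk (@finrank_euclideanSpace_fin ℝ _ (2 + 1))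
  exact contDiff_invZetaVec.contMDiff.codRestrict_sphere fun ζ => (invZeta ζ).2

/-- **`invXi` is smooth.** [folklore] -/
theorem contMDiff_invXi : ContMDiff 𝓘(ℝ, ℂ) (𝓡 2) ∞ invXi := by
  haveI := Fact.mk (@finrank_euclideanSpace_fin ℝ _ (2 + 1))
  exact contDiff_invXiVec.contMDiff.codRestrict_sphere fun u => (invXi u).2

/-- `invZeta` is continuous. [folklore] -/
theorem continuous_invZeta : Continuous invZeta := contMDiff_invZeta.continuous

/-- `invXi` is continuous. [folklore] -/
theorem continuous_invXi : Continuous invXi := contMDiff_invXi.continuous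

/-- `zeta` is continuous off the north pole. [folklore] -/
theorem continuousOn_zeta : ContinuousOn zeta {x | x ≠ northPole} :=
  contMDiffOn_zeta.continuousOn

/-- `xi` is continuous off the south pole. [folklore] -/
theorem continuousOn_xi : ContinuousOn xi {x | x ≠ southPole} := contMDiffOn_xi.continuousOn

/-! ### Rotations about the polar axis -/

/-- The unit complex number `u₀ + i u₁` of a point of the circle `𝕊 1`. [folklore] -/
def circleComplex (u : 𝕊 1) : ℂ := ⟨(u : 𝔼 2) 0, (u : 𝔼 2) 1⟩

/-- `|u₀ + i u₁|² = 1` on the circle. [folklore] -/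
@[simp] theorem normSq_circleComplex (u : 𝕊 1) : normSq (circleComplex u) = 1 := by
  have hu := norm_eq_of_mem_sphere u
  rw [EuclideanSpace.norm_eq, Real.sqrt_eq_one, Fin.sum_univ_two] at hu
  simp only [Real.norm_eq_abs, sq_abs] at hu
  rw [normSq_apply, circleComplex]
  nlinarith [hu]

/-- `circleComplex u ≠ 0`. [folklore] -/
theorem circleComplex_ne_zero (u : 𝕊 1) : circleComplex u ≠ 0 := by
  rw [← normSq_pos, normSq_circleComplex]; exact one_pos

/-- The conjugate of `circleComplex u` is its inverse. [folklore] -/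
theorem conj_circleComplex (u : 𝕊 1) : conj (circleComplex u) = (circleComplex u)⁻¹ := by
  rw [inv_def, normSq_circleComplex]; simp

/-- The rotation preserves the north pole (it fixes the last coordinate). [folklore] -/
theorem rotateSphereTwo_eq_northPole_iff (u : 𝕊 1) (x : 𝕊 2) :
    rotateSphereTwo u x = northPole ↔ x = northPole := by
  rw [eq_northPole_iff, eq_northPole_iff, rotateSphereTwo_apply_two]

/-- The rotation preserves the south pole. [folklore] -/
theorem rotateSphereTwo_eq_southPole_iff (u : 𝕊 1) (x : 𝕊 2) :
    rotateSphereTwo u x = southPole ↔ x = southPole := by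
  rw [eq_southPole_iff, eq_southPole_iff, rotateSphereTwo_apply_two]

/-- The rotation multiplies the equatorial coordinate by the unit complex number:
`eqC (rot_u x) = u • eqC x`. [folklore] -/
theorem eqC_rotateSphereTwo (u : 𝕊 1) (x : 𝕊 2) :
    eqC (rotateSphereTwo u x) = circleComplex u * eqC x := by
  apply Complex.ext
  · simp [eqC, circleComplex, mul_re]
  · simp only [eqC, circleComplex, mul_im, rotateSphereTwo_apply_one]; ring

/-- **`ζ (rot_u x) = u ζ(x)`**: in the stereographic coordinate the rotation about the polar axis
is multiplication by the unit complex number. [folklore] -/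
theorem zeta_rotateSphereTwo (u : 𝕊 1) (x : 𝕊 2) :
    zeta (rotateSphereTwo u x) = circleComplex u * zeta x := by
  rw [zeta, zeta, rotateSphereTwo_apply_two, eqC_rotateSphereTwo, mul_assoc]

/-- **`ξ (rot_u x) = ū ξ(x)`**. [folklore] -/
theorem xi_rotateSphereTwo (u : 𝕊 1) (x : 𝕊 2) :
    xi (rotateSphereTwo u x) = conj (circleComplex u) * xi x := by
  rw [xi, xi, rotateSphereTwo_apply_two, eqC_rotateSphereTwo, map_mul, mul_assoc]

/-- The unit vector of `w ≠ 0` as a complex number is `w/‖w‖` (with `w` read as `w₀ + i w₁`).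
[folklore] -/
theorem circleComplex_unitVector (w : 𝔼 2) (hw : w ≠ 0) :
    circleComplex (unitVector w hw) = (((‖w‖⁻¹ : ℝ) : ℂ)) * (⟨w 0, w 1⟩ : ℂ) := by
  apply Complex.ext
  · rw [re_ofReal_mul]; simp [circleComplex, coe_unitVector]
  · rw [im_ofReal_mul]; simp [circleComplex, coe_unitVector]

/-! ### Products of complex-valued smooth functions on manifolds -/

section ComplexMul

variable {EM HM : Type*} [NormedAddCommGroup EM] [NormedSpace ℝ EM] [TopologicalSpace HM]
  {IM : ModelWithCorners ℝ EM HM} {M : Type*} [TopologicalSpace M] [ChartedSpace HM M]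

/-- The product of two `C^∞` complex-valued functions on a real manifold is `C^∞` (through the
smooth bilinear map `ℂ × ℂ → ℂ`; stated here because the tree's Mathlib pin has no
`ContMDiffMul 𝓘(ℝ, ℂ)` instance in scope). [folklore] -/
theorem contMDiffAt_mul_complex {f g : M → ℂ} {x : M} (hf : ContMDiffAt IM 𝓘(ℝ, ℂ) ∞ f x)
    (hg : ContMDiffAt IM 𝓘(ℝ, ℂ) ∞ g x) : ContMDiffAt IM 𝓘(ℝ, ℂ) ∞ (fun y => f y * g y) x :=
  (contDiff_fst.mul contDiff_snd : ContDiff ℝ ∞ fun p : ℂ × ℂ => p.1 * p.2).comp_contMDiffAt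
    (hf.prodMk_space hg)

/-- The inverse of a nonvanishing `C^∞` complex-valued function on a real manifold is `C^∞`.
[folklore] -/
theorem contMDiffAt_inv_complex {f : M → ℂ} {x : M} (hf : ContMDiffAt IM 𝓘(ℝ, ℂ) ∞ f x)
    (h0 : f x ≠ 0) : ContMDiffAt IM 𝓘(ℝ, ℂ) ∞ (fun y => (f y)⁻¹) x :=
  (contDiffAt_inv ℝ h0).comp_contMDiffAt hf

end ComplexMul

/-! ### The Möbius maps `ζ ↦ 1/(c ζ)` -/

/-- **The Möbius involution `ζ ↦ (c ζ)⁻¹`** of the sphere, for a complex parameter `c` (used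
for `c ≠ 0`): the point with `ζ`-coordinate `ξ(x)/c = (c ζ(x))⁻¹`. It exchanges the poles; for
`|c| = 1` it is the half-turn `(x₀, x₁, x₂) ↦ (x₀, -x₁, -x₂)` followed by the rotation by `c̄`,
and for real `c > 0` it is the half-turn followed by the conformal dilation by `c⁻¹`. Written
through both charts: `invZeta (ξ(x) c⁻¹)` at the north pole, `invXi (ζ(x) c)` elsewhere.
[folklore] -/
def moebius (c : ℂ) (x : 𝕊 2) : 𝕊 2 :=
  if x = northPole then invZeta (xi x * c⁻¹) else invXi (zeta x * c)

/-- The Möbius map at the north pole: the south pole. [folklore] -/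
@[simp] theorem moebius_northPole (c : ℂ) : moebius c northPole = southPole := by
  simp [moebius]

/-- The Möbius map at the south pole: the north pole. [folklore] -/
@[simp] theorem moebius_southPole (c : ℂ) : moebius c southPole = northPole := by
  rw [moebius, if_neg northPole_ne_southPole.symm, zeta_southPole, zero_mul, invXi_zero]

/-- Off the north pole, `moebius c x = invXi (ζ(x) c)`. [folklore] -/
theorem moebius_of_ne_northPole (c : ℂ) {x : 𝕊 2} (hN : x ≠ northPole) :
    moebius c x = invXi (zeta x * c) := by
  rw [moebius, if_neg hN]

/-- Off the south pole (and for `c ≠ 0`), `moebius c x = invZeta (ξ(x) c⁻¹)`: the two chart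
expressions agree. [folklore] -/
theorem moebius_of_ne_southPole {c : ℂ} (hc : c ≠ 0) {x : 𝕊 2} (hS : x ≠ southPole) :
    moebius c x = invZeta (xi x * c⁻¹) := by
  by_cases hN : x = northPole
  · rw [moebius, if_pos hN]
  · rw [moebius_of_ne_northPole c hN, invXi_eq_invZeta_inv, mul_inv, ← xi_eq_inv_zeta hN hS]
    exact mul_ne_zero ((zeta_eq_zero_iff hN).not.2 hS) hc

/-- `moebius c x` is the north pole iff `x` is the south pole (`c ≠ 0`). [folklore] -/
theorem moebius_eq_northPole_iff {c : ℂ} (hc : c ≠ 0) (x : 𝕊 2) :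
    moebius c x = northPole ↔ x = southPole := by
  by_cases hN : x = northPole
  · subst hN
    rw [moebius_northPole]
    exact ⟨fun h => absurd h.symm northPole_ne_southPole, fun h => absurd h northPole_ne_southPole⟩
  · rw [moebius_of_ne_northPole c hN, invXi_eq_northPole_iff, mul_eq_zero, zeta_eq_zero_iff hN]
    exact or_iff_left hc

/-- `moebius c x` is the south pole iff `x` is the north pole (`c ≠ 0`). [folklore] -/
theorem moebius_eq_southPole_iff {c : ℂ} (hc : c ≠ 0) (x : 𝕊 2) :
    moebius c x = southPole ↔ x = northPole := by
  by_cases hS : x = southPole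
  · subst hS
    rw [moebius_southPole]
    exact ⟨fun h => absurd h northPole_ne_southPole, fun h => absurd h.symm northPole_ne_southPole⟩
  · rw [moebius_of_ne_southPole hc hS, invZeta_eq_southPole_iff, mul_eq_zero, xi_eq_zero_iff hS]
    exact or_iff_left (inv_ne_zero hc)

/-- **The coordinate of the Möbius map**: `ζ (moebius c x) = (c ζ(x))⁻¹` off the poles.
[folklore] -/
theorem zeta_moebius {c : ℂ} (hc : c ≠ 0) {x : 𝕊 2} (hN : x ≠ northPole) (hS : x ≠ southPole) :
    zeta (moebius c x) = (zeta x * c)⁻¹ := by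
  rw [moebius_of_ne_northPole c hN, zeta_invXi]
  exact mul_ne_zero ((zeta_eq_zero_iff hN).not.2 hS) hc

/-- `ξ (moebius c x) = ζ(x) c` off the north pole. [folklore] -/
theorem xi_moebius (c : ℂ) {x : 𝕊 2} (hN : x ≠ northPole) : xi (moebius c x) = zeta x * c := by
  rw [moebius_of_ne_northPole c hN, xi_invXi]

/-- **The Möbius map is an involution** (`c ≠ 0`): `ζ ↦ (c ζ)⁻¹ ↦ ζ`. [folklore] -/
theorem moebius_moebius {c : ℂ} (hc : c ≠ 0) (x : 𝕊 2) : moebius c (moebius c x) = x := by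
  by_cases hN : x = northPole
  · subst hN; simp
  by_cases hS : x = southPole
  · subst hS; simp
  have hN' : moebius c x ≠ northPole := (moebius_eq_northPole_iff hc x).not.2 hS
  have hS' : moebius c x ≠ southPole := (moebius_eq_southPole_iff hc x).not.2 hN
  have hN'' : moebius c (moebius c x) ≠ northPole := (moebius_eq_northPole_iff hc _).not.2 hS'
  apply zeta_injOn hN'' hN
  rw [zeta_moebius hc hN' hS', zeta_moebius hc hN hS, mul_inv, inv_inv, mul_assoc,
    mul_inv_cancel₀ hc, mul_one]

/-- **Rotations and the Möbius maps**: `rot_u (moebius c x) = moebius (ū c) x` — rotating by `u`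
multiplies `ζ` by `u`, i.e. divides the parameter by `u`. [folklore] -/
theorem rotateSphereTwo_moebius (u : 𝕊 1) {c : ℂ} (hc : c ≠ 0) (x : 𝕊 2) :
    rotateSphereTwo u (moebius c x) = moebius (conj (circleComplex u) * c) x := by
  have hu := circleComplex_ne_zero u
  have huc : conj (circleComplex u) * c ≠ 0 := mul_ne_zero ((map_ne_zero _).2 hu) hc
  by_cases hN : x = northPole
  · subst hN
    rw [moebius_northPole, moebius_northPole, rotateSphereTwo_eq_southPole_iff]
  by_cases hS : x = southPole
  · subst hS
    rw [moebius_southPole, moebius_southPole, rotateSphereTwo_eq_northPole_iff]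
  have hN' : moebius c x ≠ northPole := (moebius_eq_northPole_iff hc x).not.2 hS
  have hS' : moebius c x ≠ southPole := (moebius_eq_southPole_iff hc x).not.2 hN
  have hN'' : rotateSphereTwo u (moebius c x) ≠ northPole :=
    (rotateSphereTwo_eq_northPole_iff u _).not.2 hN'
  apply zeta_injOn hN'' ((moebius_eq_northPole_iff huc x).not.2 hS)
  rw [zeta_rotateSphereTwo, zeta_moebius hc hN hS, zeta_moebius huc hN hS, conj_circleComplex]
  field_simp

/-- **The Möbius map with the Gluck rotation**: for `w ≠ 0` read as the complex number `c`
(so that `rot_{w/‖w‖}` multiplies `ζ` by `c/‖c‖`), `rot_{w/‖w‖} (moebius c x) = moebius ‖c‖ x`: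
the rotation of Gluck's map turns the complex Möbius map into the real one (half-turn and
dilation by `‖c‖⁻¹`). [folklore] -/
theorem rotateSphereTwo_unitVector_moebius (w : 𝔼 2) (hw : w ≠ 0) (x : 𝕊 2) :
    rotateSphereTwo (unitVector w hw) (moebius ⟨w 0, w 1⟩ x) = moebius (‖w‖ : ℂ) x := by
  have hc : (⟨w 0, w 1⟩ : ℂ) ≠ 0 := by
    intro h
    apply hw
    ext i
    fin_cases i
    · exact congrArg Complex.re h
    · exact congrArg Complex.im h
  rw [rotateSphereTwo_moebius _ hc, circleComplex_unitVector, map_mul, conj_ofReal, mul_assoc,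
    mul_comm (conj _), mul_conj]
  congr 1
  have hn : normSq (⟨w 0, w 1⟩ : ℂ) = ‖w‖ ^ 2 := by
    rw [normSq_apply, EuclideanSpace.real_norm_sq_eq, Fin.sum_univ_two]; ring
  rw [hn]
  have hw' : (‖w‖ : ℂ) ≠ 0 := ofReal_ne_zero.2 (norm_ne_zero_iff.2 hw)
  push_cast
  field_simp

/-! ### Smoothness of the Möbius maps -/

section MoebiusSmooth

variable {EM HM : Type*} [NormedAddCommGroup EM] [NormedSpace ℝ EM] [TopologicalSpace HM]
  {IM : ModelWithCorners ℝ EM HM} {M : Type*} [TopologicalSpace M] [ChartedSpace HM M]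

/-- **Joint smoothness of the Möbius maps**: if `c : M → ℂ` is smooth and nowhere zero and
`g : M → 𝕊 2` is smooth, then `m ↦ moebius (c m) (g m)` is smooth (near points with `g m ≠ N` it
is `invXi (ζ(g) c)`, near points with `g m ≠ S` it is `invZeta (ξ(g) c⁻¹)`). [folklore] -/
theorem contMDiffAt_moebius {c : M → ℂ} {g : M → 𝕊 2} {m : M} (hc : ContMDiffAt IM 𝓘(ℝ, ℂ) ∞ c m)
    (hc0 : ∀ m', c m' ≠ 0) (hg : ContMDiffAt IM (𝓡 2) ∞ g m) :
    ContMDiffAt IM (𝓡 2) ∞ (fun m' => moebius (c m') (g m')) m := by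
  have hgc : ContinuousAt g m := hg.continuousAt
  by_cases hN : g m = northPole
  · -- near `m`, `g ≠ S`, and the map is `invZeta (ξ(g) c⁻¹)`
    have hS : g m ≠ southPole := by rw [hN]; exact northPole_ne_southPole
    have ho : IsOpen {x : 𝕊 2 | x ≠ southPole} := isOpen_ne
    have hev : (fun m' => moebius (c m') (g m')) =ᶠ[𝓝 m] fun m' => invZeta (xi (g m') * (c m')⁻¹) := by
      filter_upwards [hgc.preimage_mem_nhds (ho.mem_nhds hS)] with m' hm'
      exact moebius_of_ne_southPole (hc0 m') hm'
    refine ContMDiffAt.congr_of_eventuallyEq ?_ hev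
    exact contMDiff_invZeta.contMDiffAt.comp m
      (contMDiffAt_mul_complex ((contMDiffAt_xi hS).comp m hg) (contMDiffAt_inv_complex hc (hc0 m)))
  · have ho : IsOpen {x : 𝕊 2 | x ≠ northPole} := isOpen_ne
    have hev : (fun m' => moebius (c m') (g m')) =ᶠ[𝓝 m] fun m' => invXi (zeta (g m') * c m') := by
      filter_upwards [hgc.preimage_mem_nhds (ho.mem_nhds hN)] with m' hm'
      exact moebius_of_ne_northPole _ hm'
    refine ContMDiffAt.congr_of_eventuallyEq ?_ hev
    exact contMDiff_invXi.contMDiffAt.comp m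
      (contMDiffAt_mul_complex ((contMDiffAt_zeta hN).comp m hg) hc)

/-- Global form of `contMDiffAt_moebius`. [folklore] -/
theorem contMDiff_moebius {c : M → ℂ} {g : M → 𝕊 2} (hc : ContMDiff IM 𝓘(ℝ, ℂ) ∞ c)
    (hc0 : ∀ m', c m' ≠ 0) (hg : ContMDiff IM (𝓡 2) ∞ g) :
    ContMDiff IM (𝓡 2) ∞ fun m' => moebius (c m') (g m') := fun m =>
  contMDiffAt_moebius (hc m) hc0 (hg m)

/-- For a fixed `c ≠ 0` the Möbius map is smooth. [folklore] -/
theorem contMDiff_moebius_right {c : ℂ} (hc : c ≠ 0) : ContMDiff (𝓡 2) (𝓡 2) ∞ (moebius c) :=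
  contMDiff_moebius contMDiff_const (fun _ => hc) contMDiff_id

end MoebiusSmooth

end SphereCoord

end Literature.Topology.FourManifolds
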